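import Summits.QuantumFields.YangMills.Theses.FemtoCutoffLadder
import Summits.QuantumFields.YangMills.Theses.FlatTubeReduction
import Summits.QuantumFields.YangMills.Theorems.FemtoCutoffLadderSmallFieldOctaveStepAdditive
import HarnessLib

/-!
# Routes `FemtoCutoffLadder` / `FlatTubeReduction`: the ADDITIVE form of the shared crux `UpStepEv` (stmt-QuantumFields-26796), by name

Seat `leafhand-qf-femtocutoffladder-1` g0 (2026-08-30).  `UpStepEv` compares `λ₁(β',L')^{L'} · λ₀(β,L)^L` with `e^{CΛ²} · λ₁(β,L)^L · λ₀(β',L')^{L'}`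
for sub-octave pairs `L' < L < 2L'` at matched `Λ`.  Every transfer value is positive (`topValue_pos`, `secondValue_su2Rep_pos`, Lüscher 1977), so the
clause is ONE one-sided bound on the femto gap variables `z(β,L) := L·(log λ₀ − log λ₁)`:

★ `upStepEv_iff_log : UpStepEv ↔ ∃ C lam0 … z(β,L) − z(β',L') ≤ CΛ²` (prefix VERBATIM) — «fine torelon mass ≤ coarse torelon mass + CΛ² per unit
physical time», the variational direction of the informal statement; `ftr_upStepEv_iff_log` is the `FlatTubeReduction` copy (same body).
Tool: `oneSided_comparison_iff_log` (p794597).  HONEST FRAMING: a by-name door; the bound (open: (P2) two-cutoff vacuum-chain wall / RED 19978) is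
untouched.  R2b1 is a RECORD rung: not infinite volume, not a mass gap, not Clay; no summit is proved by this file.  No definitions, no `sorry`.
-/

set_option autoImplicit false

noncomputable section

namespace Summit.QuantumFields.YangMills.Theorems.FemtoCutoffLadder

open Literature.MathematicalPhysics.QuantumFieldTheory hiding SU2
open Summit.QuantumFields.YangMills.Theorems.FemtoTransferGap

/-- ★ **`UpStepEv` ⟺ its additive form** `z(β,L) − z(β',L') ≤ CΛ²` for all sub-octave pairs deep in the window (`oneSided_comparison_iff_log` with
`secondValue_su2Rep_pos`, `topValue_pos`; `β, β' ≥ 1` on the windows). [folklore] -/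
theorem upStepEv_iff_log :
    Summit.QuantumFields.YangMills.Theses.FemtoCutoffLadder.UpStepEv ↔
      (∃ C lam0 : ℝ, 0 < lam0 ∧ ∀ lam : ℝ, 0 < lam → lam ≤ lam0 → ∃ L0 : ℕ, ∀ (L' : ℕ) [NeZero L'] (L : ℕ) [NeZero L], L0 ≤ L' → L' < L → L < 2 * L' → ∀ β β' : ℝ, InFemtoWindow lam β L → InFemtoWindow lam β' L' → luscherLambda β L = luscherLambda β' L' → (L : ℝ) * (Real.log (topValue su2Rep L β) - Real.log (secondValue su2Rep L β)) - (L' : ℝ) * (Real.log (topValue su2Rep L' β') - Real.log (secondValue su2Rep L' β')) ≤ C * luscherLambda β L ^ 2) := by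
  constructor
  · rintro ⟨C, lam0, hlam0, H⟩
    refine ⟨C, lam0, hlam0, fun lam hlam hle => ?_⟩
    obtain ⟨L0, H'⟩ := H lam hlam hle
    refine ⟨L0, fun L' _ L _ hL0 hlt h2 β β' hW hW' hΛ => ?_⟩
    have hβ : 0 < β := by linarith [hW.1]
    have hβ' : 0 < β' := by linarith [hW'.1]
    exact (oneSided_comparison_iff_log (secondValue_su2Rep_pos hβ') (topValue_pos su2Rep continuous_su2Rep (L := L') β')
      (secondValue_su2Rep_pos hβ) (topValue_pos su2Rep continuous_su2Rep (L := L) β) L' L).mp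
      (H' L' L hL0 hlt h2 β β' hW hW' hΛ)
  · rintro ⟨C, lam0, hlam0, H⟩
    refine ⟨C, lam0, hlam0, fun lam hlam hle => ?_⟩
    obtain ⟨L0, H'⟩ := H lam hlam hle
    refine ⟨L0, fun L' _ L _ hL0 hlt h2 β β' hW hW' hΛ => ?_⟩
    have hβ : 0 < β := by linarith [hW.1]
    have hβ' : 0 < β' := by linarith [hW'.1]
    exact (oneSided_comparison_iff_log (secondValue_su2Rep_pos hβ') (topValue_pos su2Rep continuous_su2Rep (L := L') β')
      (secondValue_su2Rep_pos hβ) (topValue_pos su2Rep continuous_su2Rep (L := L) β) L' L).mpr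
      (H' L' L hL0 hlt h2 β β' hW hW' hΛ)

/-- The `FlatTubeReduction` copy of the crux (same body) ⟺ the same additive form. [folklore] -/
theorem ftr_upStepEv_iff_log :
    Summit.QuantumFields.YangMills.Theses.FlatTubeReduction.UpStepEv ↔
      (∃ C lam0 : ℝ, 0 < lam0 ∧ ∀ lam : ℝ, 0 < lam → lam ≤ lam0 → ∃ L0 : ℕ, ∀ (L' : ℕ) [NeZero L'] (L : ℕ) [NeZero L], L0 ≤ L' → L' < L → L < 2 * L' → ∀ β β' : ℝ, InFemtoWindow lam β L → InFemtoWindow lam β' L' → luscherLambda β L = luscherLambda β' L' → (L : ℝ) * (Real.log (topValue su2Rep L β) - Real.log (secondValue su2Rep L β)) - (L' : ℝ) * (Real.log (topValue su2Rep L' β') - Real.log (secondValue su2Rep L' β')) ≤ C * luscherLambda β L ^ 2) := by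
  constructor
  · rintro ⟨C, lam0, hlam0, H⟩
    refine ⟨C, lam0, hlam0, fun lam hlam hle => ?_⟩
    obtain ⟨L0, H'⟩ := H lam hlam hle
    refine ⟨L0, fun L' _ L _ hL0 hlt h2 β β' hW hW' hΛ => ?_⟩
    have hβ : 0 < β := by linarith [hW.1]
    have hβ' : 0 < β' := by linarith [hW'.1]
    exact (oneSided_comparison_iff_log (secondValue_su2Rep_pos hβ') (topValue_pos su2Rep continuous_su2Rep (L := L') β')
      (secondValue_su2Rep_pos hβ) (topValue_pos su2Rep continuous_su2Rep (L := L) β) L' L).mp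
      (H' L' L hL0 hlt h2 β β' hW hW' hΛ)
  · rintro ⟨C, lam0, hlam0, H⟩
    refine ⟨C, lam0, hlam0, fun lam hlam hle => ?_⟩
    obtain ⟨L0, H'⟩ := H lam hlam hle
    refine ⟨L0, fun L' _ L _ hL0 hlt h2 β β' hW hW' hΛ => ?_⟩
    have hβ : 0 < β := by linarith [hW.1]
    have hβ' : 0 < β' := by linarith [hW'.1]
    exact (oneSided_comparison_iff_log (secondValue_su2Rep_pos hβ') (topValue_pos su2Rep continuous_su2Rep (L := L') β')
      (secondValue_su2Rep_pos hβ) (topValue_pos su2Rep continuous_su2Rep (L := L) β) L' L).mpr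
      (H' L' L hL0 hlt h2 β β' hW hW' hΛ)

end Summit.QuantumFields.YangMills.Theorems.FemtoCutoffLadder

end
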